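import Summits.Ventures.HodgeRepro2.T5InertDegreeGalois
import Summits.Ventures.HodgeRepro2.T5InertPlaceFrobenius
import Summits.Ventures.HodgeRepro2.T5InertPlaceCompletion

/-!
# The inert hypothesis on the record's local fields: `σ̄ ≠ 1` gives `ResidueConjNontrivial`
(cell pub-hodge-repro2, seat p3)

Tier-5 N3 support. File 205 counts `deg Tₙ = (q³ + 1) q^{4n−3}` on seat p8's Galois package `(R₀, F, E, τ)`
under `ResidueConjNontrivial τ ϖ` («`∃ x ∈ 𝒪_E`, `x − τ x ∉ ϖ 𝒪_E`»). On Mathlib's completions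
`K_v ⊆ L_w` of the record's number fields, seat p8's T5-170 (`T5InertPlaceFrobenius`) proves that the
residue involution `σ̄` induced by `σ ∈ Gal(L_w/K_v)`, `σ ≠ 1`, is non-trivial when `e(w/v) = 1` and
`[L_w : K_v] = 2`. This file reads that statement in the vocabulary of file 205:

* **`residueConjNontrivial_adicCompletion`** — for `R₀ = O_{K_v}`, `E = L_w`, `τ = σ`, a uniformiser `ϖ` of
  `O_{K_v}` which stays irreducible in `O_{L_w}` (p8's `hinert`): `ResidueConjNontrivial σ ϖ`. A class `t` of
  the residue field of `O_{L_w}` with `σ̄ t ≠ t` lifts to `x ∈ O_{L_w}` with `σ x − x ∉ 𝔪 = ϖ O_{L_w}`, which is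
  the statement for `O_{L_w}`; p8's T5-146 identifies the integral elements of `L_w` over `O_{L_w}` and over
  `integralClosure O_{K_v} L_w`.

Hence every theorem of file 205 applies on the record's local fields with `hnt := residueConjNontrivial_adicCompletion`.

Mathlib + this seat's file 205 + p8's T5-146 / T5-170 and their imports; no display; no device.
§8(d): uses an L-value-free non-vanishing device: NO.
-/

namespace Summit.Ventures.HodgeRepro2.T5InertDegreeCompletion

open IsDedekindDomain HeightOneSpectrum
open Summit.Ventures.HodgeRepro2.T5InertPlaceFrobenius Summit.Ventures.HodgeRepro2.T5InertPlaceCompletion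
  Summit.Ventures.HodgeRepro2.T5InertDegreeGalois

section Completion

variable {K : Type*} [Field K] [NumberField K] (v : HeightOneSpectrum (NumberField.RingOfIntegers K))
  {L : Type*} [Field L] [NumberField L] [Algebra K L] (w : HeightOneSpectrum (NumberField.RingOfIntegers L))
  [w.asIdeal.LiesOver v.asIdeal]

/-- A non-trivial algebra automorphism moves some element. -/
theorem exists_ne_of_ne_one {R k : Type*} [CommSemiring R] [Semiring k] [Algebra R k] {f : k ≃ₐ[R] k}
    (hf : f ≠ 1) : ∃ t : k, f t ≠ t := by
  by_contra h
  exact hf (AlgEquiv.ext fun t => by_contra fun h' => h ⟨t, h'⟩)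

/-- **The inert hypothesis of file 205 on the record's local fields.** For `e(w/v) = 1`, `[L_w : K_v] = 2`,
`σ ∈ Gal(L_w/K_v)` non-trivial and a uniformiser `ϖ` of `O_{K_v}` irreducible in `O_{L_w}`:
`∃ x ∈ integralClosure O_{K_v} L_w`, `x − σ x ∉ ϖ · integralClosure O_{K_v} L_w`. -/
theorem residueConjNontrivial_adicCompletion (he : v.asIdeal.ramificationIdx' w.asIdeal = 1)
    (h2 : Module.finrank (v.adicCompletion K) (w.adicCompletion L) = 2)
    (σ : (w.adicCompletion L) ≃ₐ[v.adicCompletion K] (w.adicCompletion L)) (hσ : σ ≠ 1)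
    {ϖ : v.adicCompletionIntegers K}
    (hinert : Irreducible (algebraMap (v.adicCompletionIntegers K) (w.adicCompletionIntegers L) ϖ)) :
    ResidueConjNontrivial σ ϖ := by
  -- a class moved by `σ̄`, and a lift `x ∈ O_{L_w}`
  obtain ⟨t, ht⟩ := exists_ne_of_ne_one (mapAlgEquiv'_galRestrict_ne_one v w he h2 σ hσ)
  obtain ⟨x, rfl⟩ := IsLocalRing.residue_surjective t
  rw [residue_galRestrict v w σ x, ne_eq, ← sub_eq_zero, ← map_sub, IsLocalRing.residue_eq_zero_iff,
    hinert.maximalIdeal_eq, Ideal.mem_span_singleton] at ht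
  -- the element of `integralClosure O_{K_v} L_w`
  set gx := galRestrict (v.adicCompletionIntegers K) (v.adicCompletion K) (w.adicCompletion L)
    (w.adicCompletionIntegers L) σ x with hgx
  set x' : integralClosure (v.adicCompletionIntegers K) (w.adicCompletion L) :=
    ⟨(x : w.adicCompletion L), (IsIntegralClosure.isIntegral_iff (A := w.adicCompletionIntegers L)).mpr ⟨x, rfl⟩⟩
    with hx'
  refine ⟨x', fun hint => ht ?_⟩
  -- read the integrality over `O_{L_w}` (p8's T5-146) and rewrite `x`, `σ x`, `ϖ`
  rw [isInteger_integralClosure_iff_of_isIntegralClosure (A := w.adicCompletionIntegers L)] at hint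
  obtain ⟨y, hy⟩ := hint
  have hxx : algebraMap (integralClosure (v.adicCompletionIntegers K) (w.adicCompletion L))
      (w.adicCompletion L) x' = algebraMap (w.adicCompletionIntegers L) (w.adicCompletion L) x := rfl
  have hσx : σ (algebraMap (w.adicCompletionIntegers L) (w.adicCompletion L) x) =
      algebraMap (w.adicCompletionIntegers L) (w.adicCompletion L) gx := by
    rw [hgx, algebraMap_galRestrict_apply]
  have hϖ : algebraMap (integralClosure (v.adicCompletionIntegers K) (w.adicCompletion L)) (w.adicCompletion L)
      (algebraMap (v.adicCompletionIntegers K) (integralClosure (v.adicCompletionIntegers K) (w.adicCompletion L))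
        ϖ) = algebraMap (w.adicCompletionIntegers L) (w.adicCompletion L)
          (algebraMap (v.adicCompletionIntegers K) (w.adicCompletionIntegers L) ϖ) := by
    rw [← IsScalarTower.algebraMap_apply, ← IsScalarTower.algebraMap_apply]
  rw [hxx, hσx, hϖ] at hy
  have hϖ0 : algebraMap (w.adicCompletionIntegers L) (w.adicCompletion L)
      (algebraMap (v.adicCompletionIntegers K) (w.adicCompletionIntegers L) ϖ) ≠ 0 :=
    (map_ne_zero_iff _ (IsFractionRing.injective _ _)).2 hinert.ne_zero
  refine ⟨-y, IsFractionRing.injective (w.adicCompletionIntegers L) (w.adicCompletion L) ?_⟩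
  rw [map_sub, map_mul, map_neg, hy, mul_neg, mul_comm (algebraMap (w.adicCompletionIntegers L)
    (w.adicCompletion L) (algebraMap (v.adicCompletionIntegers K) (w.adicCompletionIntegers L) ϖ)), mul_assoc,
    inv_mul_cancel₀ hϖ0, mul_one, neg_sub]

end Completion

end Summit.Ventures.HodgeRepro2.T5InertDegreeCompletion
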